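import Mathlib
import HarnessLib
import Literature.Probability.MarkovChains.TotalVariation
import Literature.Probability.Entropy.PinskerInequality
import Summits.Ventures.LatticeQCDFlow.Exactness.NCMCAcceptance
import Summits.Ventures.LatticeQCDFlow.Exactness.FrozenExteriorAcceptance
import Summits.Ventures.LatticeQCDFlow.Scaling.StochasticFlows
import Summits.Ventures.LatticeQCDFlow.Scaling.StochasticBudgets
import Summits.Ventures.LatticeQCDFlow.Scaling.Bhattacharyya
import Summits.Ventures.LatticeQCDFlow.Scaling.SectorBudget

/-!
# Caps and floors of the NCMC acceptance: end-point law, half-work average, mean dissipation, frozen exterior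

HONEST FRAMING: exact (Metropolis-corrected) sampling algorithms for lattice gauge theory;
figures of merit are autocorrelation/cost numbers at stated couplings and volumes; no
continuum-physics claim.

Venture `LatticeQCDFlow` (cell pub-lqcd), topic `Exactness`; FANOUT row 8 (`s0-cpn-nemc`, GEN-8).
NEW WORK of the cell (elementary finite sums), not a published result; nothing is cited as a fact.
Companion of `Exactness/NCMCAcceptance.lean`, whose identity `acc_NCMC = 1 − ‖P_F − P_R‖_TV`
(`ncmcAccRate_eq_one_sub_tvDist`) for the Metropolized non-equilibrium switch (Nilmeier–Crooks–
Minh–Chodera 2011, named only) is turned here into bounds by quantities an NE-MCMC run records.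

## Content

* `tvDist_coarse_le` — data processing for the finite total variation along any coarse-graining
  (`Theory2.coarse`); `ncmcAccRate_le_one_sub_tvDist_coarse`;
  **`ncmcAccRate_le_one_sub_tvDist_endpoint`** — `acc_NCMC ≤ 1 − ‖q_n − p_n‖_TV`, `q_n` the law of
  the UNCORRECTED evolution's end point, `p_n` the target: a Metropolized switch cannot accept more
  often than its raw output overlaps the target (and likewise for every coarse observable of the
  path, e.g. the topological charge of the end point).
* `ncmcAccRate_le_halfWork`, `bhatt_path_eq`, `one_sub_sqrt_le_ncmcAccRate` — the HALF-WORK average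
  `B = ⟨e^{-(W − ΔF)/2}⟩_F` is the Bhattacharyya coefficient of `P_F, P_R` and sandwiches the
  acceptance: `1 − √(1 − B²) ≤ acc_NCMC ≤ B` (termwise `min ≤ geometric mean`; Le Cam
  `Theory2.bhatt_sq_le`).
* **`one_sub_sqrt_half_dissipation_le_ncmcAccRate`** — Pinsker floor from the mean dissipated work:
  `acc_NCMC ≥ 1 − √((⟨W⟩_F − ΔF)/2)` (`Literature.Probability.Entropy.two_mul_tvDist_sq_le_kl` +
  `Theory2.kl_path_eq_dissipation`).
* Frozen exterior (row 13's / row 8's defect-ball setting, `Exactness/FrozenExterior*.lean`):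
  `frozenTiltedLaw_eq_fwd_mul_exp`, `sum_min_frozen_eq`, **`sum_min_frozen_le_one_sub_tvDist`**,
  `accRate_frozen_le_sum_min_frozen` — the NCMC acceptance of a frozen-exterior protocol is
  `Σ min(fwd, tilted) = 1 − TV(fwd, tilted) ≤ 1 − TV(π₁^ext, π₀^ext)`, the same exterior-only cap
  as the path-IMH acceptance (GEN-7's `accRate_frozen_le_one_sub_tvDist`), which it dominates; so
  the flow seat's BALL-FLOOR §1 (iv) holds for BOTH Metropolizations, for every number of steps and
  every exterior-freezing interior kernel.

Dictionary (Gaussian work `W − ΔF ∼ N(σ²/2, σ²)`, NOT typed): `B = e^{−σ²/8}`, Pinsker floor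
`1 − σ/2`, exact `2Φ(−σ/2)`; at row 13's quoted `Q = 0.29` (σ² = 0.58 if all dissipation were the
exterior penalty) the window reads `[0.62 (Pinsker), 0.93 (B)]` around `2Φ(−0.38) = 0.70`.
-/

namespace Summit.Ventures.LatticeQCDFlow.Exactness

open Finset
open Literature.Probability.MarkovChains
open Summit.Ventures.LatticeQCDFlow.Theory2 (revPathLaw pathLaw_pos pathLaw_nonneg revPathLaw_pos
  revPathLaw_nonneg gibbsLaw_pos sum_gibbsLaw coarse coarse_last_revPathLaw sum_revPathLaw
  kl_path_eq_dissipation klFin bhatt bhatt_sq_le sum_min_eq_one_sub_tvDist)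

variable {X : Type*} [Fintype X] {n : ℕ}

/-! ## Data processing: coarse observables of the path cap the acceptance -/

section Coarse

variable {Y : Type*} [Fintype Y] [DecidableEq Y]

omit [Fintype X] in
/-- DATA PROCESSING for the finite total variation along a coarse-graining `g : X → Y`
(`Theory2.coarse`): `‖g_* p − g_* q‖_TV ≤ ‖p − q‖_TV` (`|Σ_fibre (p − q)| ≤ Σ_fibre |p − q|`). -/
theorem tvDist_coarse_le [Fintype X] (g : X → Y) (p q : X → ℝ) :
    tvDist (coarse g p) (coarse g q) ≤ tvDist p q := by
  unfold tvDist coarse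
  refine mul_le_mul_of_nonneg_left ?_ (by norm_num)
  rw [← Finset.sum_fiberwise univ g (fun x => |p x - q x|)]
  refine sum_le_sum fun y _ => ?_
  rw [← sum_sub_distrib]
  exact abs_sum_le_sum_abs _ _

/-- `acc_NCMC ≤ 1 − ‖φ_* P_F − φ_* P_R‖_TV` for EVERY coarse-graining `φ` of path space. -/
theorem ncmcAccRate_le_one_sub_tvDist_coarse [Nonempty X] (φ : (Fin (n + 1) → X) → Y)
    (S : Fin (n + 1) → X → ℝ) {P : Fin n → X → X → ℝ} (hP : ∀ k, IsRowStochastic (P k))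
    (hst : ∀ k : Fin n, IsStationary (fun x => Real.exp (-(S k.succ x))) (P k)) :
    ncmcAccRate S P ≤
      1 - tvDist (coarse φ (pathLaw (gibbsLaw (S 0)) P)) (coarse φ (revPathLaw S P)) := by
  rw [ncmcAccRate_eq_one_sub_tvDist S hP hst]
  linarith [tvDist_coarse_le φ (pathLaw (gibbsLaw (S 0)) P) (revPathLaw S P)]

end Coarse

/-- **THE END-POINT CAP.**  `acc_NCMC ≤ 1 − ‖q_n − p_n‖_TV`, where `q_n` is the law of the end point
of the UNCORRECTED forward evolution and `p_n = e^{-S n}/Z n` the target (the end-point marginal of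
`P_R`, `Theory2.coarse_last_revPathLaw`): the Metropolized switch accepts at most as often as its raw
output overlaps the target — the same budget as the path-IMH end-point bound
`Theory2.acc_path_le_acc_endpoint`, now for the single-proposal chain. -/
theorem ncmcAccRate_le_one_sub_tvDist_endpoint [Nonempty X] [DecidableEq X]
    (S : Fin (n + 1) → X → ℝ) {P : Fin n → X → X → ℝ} (hP : ∀ k, IsRowStochastic (P k))
    (hst : ∀ k : Fin n, IsStationary (fun x => Real.exp (-(S k.succ x))) (P k)) :
    ncmcAccRate S P ≤
      1 - tvDist (coarse (fun ω : Fin (n + 1) → X => ω (Fin.last n)) (pathLaw (gibbsLaw (S 0)) P))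
        (gibbsLaw (S (Fin.last n))) := by
  have h := ncmcAccRate_le_one_sub_tvDist_coarse (fun ω : Fin (n + 1) → X => ω (Fin.last n)) S hP hst
  rwa [coarse_last_revPathLaw S P hst] at h

/-! ## The half-work (Bhattacharyya) sandwich -/

/-- `acc_NCMC ≤ ⟨e^{-(W − ΔF)/2}⟩_F`: termwise `min(P_F, P_F e^{-d}) ≤ P_F e^{-d/2}`. -/
theorem ncmcAccRate_le_halfWork [Nonempty X] (S : Fin (n + 1) → X → ℝ) {P : Fin n → X → X → ℝ}
    (hP : ∀ k x y, 0 ≤ P k x y) :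
    ncmcAccRate S P ≤ ∑ ω : Fin (n + 1) → X, pathLaw (gibbsLaw (S 0)) P ω *
      Real.exp (-((work S ω - (freeEnergy (S (Fin.last n)) - freeEnergy (S 0))) / 2)) := by
  rw [ncmcAccRate_eq_sum_min S hP]
  refine sum_le_sum fun ω _ => ?_
  have hF := pathLaw_nonneg (fun x => (gibbsLaw_pos (S 0) x).le) hP ω
  rw [revPathLaw_eq_pathLaw_mul_exp S P ω]
  set a := pathLaw (gibbsLaw (S 0)) P ω with ha
  set d := work S ω - (freeEnergy (S (Fin.last n)) - freeEnergy (S 0)) with hd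
  rcases le_or_gt 0 d with hd0 | hd0
  · calc min a (a * Real.exp (-d)) ≤ a * Real.exp (-d) := min_le_right _ _
      _ ≤ a * Real.exp (-(d / 2)) :=
          mul_le_mul_of_nonneg_left (Real.exp_le_exp.mpr (by linarith)) hF
  · calc min a (a * Real.exp (-d)) ≤ a := min_le_left _ _
      _ = a * 1 := (mul_one a).symm
      _ ≤ a * Real.exp (-(d / 2)) := mul_le_mul_of_nonneg_left (Real.one_le_exp (by linarith)) hF

/-- The half-work average IS the Bhattacharyya coefficient of the two path ensembles:
`Σ √(P_F P_R) = Σ_ω P_F(ω) e^{-(W(ω) − ΔF)/2}`. -/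
theorem bhatt_path_eq [Nonempty X] (S : Fin (n + 1) → X → ℝ) {P : Fin n → X → X → ℝ}
    (hP : ∀ k x y, 0 ≤ P k x y) :
    bhatt (pathLaw (gibbsLaw (S 0)) P) (revPathLaw S P) =
      ∑ ω : Fin (n + 1) → X, pathLaw (gibbsLaw (S 0)) P ω *
        Real.exp (-((work S ω - (freeEnergy (S (Fin.last n)) - freeEnergy (S 0))) / 2)) := by
  unfold bhatt
  refine sum_congr rfl fun ω _ => ?_
  have hF := pathLaw_nonneg (fun x => (gibbsLaw_pos (S 0) x).le) hP ω
  rw [revPathLaw_eq_pathLaw_mul_exp S P ω]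
  set a := pathLaw (gibbsLaw (S 0)) P ω with ha
  set d := work S ω - (freeEnergy (S (Fin.last n)) - freeEnergy (S 0)) with hd
  have hsq : a * (a * Real.exp (-d)) = (a * Real.exp (-(d / 2))) ^ 2 := by
    rw [mul_pow, pow_two (Real.exp _), ← Real.exp_add, show -(d / 2) + -(d / 2) = -d by ring]
    ring
  rw [hsq, Real.sqrt_sq (mul_nonneg hF (Real.exp_pos _).le)]

/-- **Lower half of the sandwich (Le Cam):** `1 − √(1 − B²) ≤ acc_NCMC`, `B` the half-work average
(`Theory2.bhatt_sq_le`: `B² ≤ 1 − TV²`).  Together with `ncmcAccRate_le_halfWork`: one recorded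
number, `⟨e^{-W_d/2}⟩_F`, locates the acceptance within `[1 − √(1 − B²), B]`. -/
theorem one_sub_sqrt_le_ncmcAccRate [Nonempty X] (S : Fin (n + 1) → X → ℝ) {P : Fin n → X → X → ℝ}
    (hP : ∀ k, IsRowStochastic (P k))
    (hst : ∀ k : Fin n, IsStationary (fun x => Real.exp (-(S k.succ x))) (P k)) :
    1 - Real.sqrt (1 - bhatt (pathLaw (gibbsLaw (S 0)) P) (revPathLaw S P) ^ 2) ≤ ncmcAccRate S P := by
  rw [ncmcAccRate_eq_one_sub_tvDist S hP hst]
  have hF0 := pathLaw_nonneg (fun x => (gibbsLaw_pos (S 0) x).le) (fun k => (hP k).1) (P := P)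
  have hR0 := revPathLaw_nonneg S (fun k => (hP k).1) (P := P)
  have hle := bhatt_sq_le hF0 hR0 (sum_pathLaw_gibbs_eq_one S hP) (sum_revPathLaw S P hst)
  have htv : tvDist (pathLaw (gibbsLaw (S 0)) P) (revPathLaw S P) ≤
      Real.sqrt (1 - bhatt (pathLaw (gibbsLaw (S 0)) P) (revPathLaw S P) ^ 2) :=
    calc tvDist (pathLaw (gibbsLaw (S 0)) P) (revPathLaw S P)
        = Real.sqrt (tvDist (pathLaw (gibbsLaw (S 0)) P) (revPathLaw S P) ^ 2) :=
          (Real.sqrt_sq (tvDist_nonneg _ _)).symm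
      _ ≤ Real.sqrt (1 - bhatt (pathLaw (gibbsLaw (S 0)) P) (revPathLaw S P) ^ 2) :=
          Real.sqrt_le_sqrt (by linarith)
  linarith

/-! ## Pinsker: the mean dissipated work floors the acceptance -/

/-- **`acc_NCMC ≥ 1 − √((⟨W⟩_F − ΔF)/2)`.**  Sharp Pinsker (`two_mul_tvDist_sq_le_kl`) with
`D(P_F ‖ P_R) = ⟨W⟩_F − ΔF` (`Theory2.kl_path_eq_dissipation`): a protocol dissipating `D` nats on
average is accepted at least `1 − √(D/2)` of the time (useful for `D < 2`; e.g. `D = 0.3 ⇒ ≥ 0.61`). -/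
theorem one_sub_sqrt_half_dissipation_le_ncmcAccRate [Nonempty X] (S : Fin (n + 1) → X → ℝ)
    {P : Fin n → X → X → ℝ} (hP : ∀ k, IsRowStochastic (P k)) (hPpos : ∀ k x y, 0 < P k x y)
    (hst : ∀ k : Fin n, IsStationary (fun x => Real.exp (-(S k.succ x))) (P k)) :
    1 - Real.sqrt (((∑ ω : Fin (n + 1) → X, pathLaw (gibbsLaw (S 0)) P ω * work S ω) -
        (freeEnergy (S (Fin.last n)) - freeEnergy (S 0))) / 2) ≤ ncmcAccRate S P := by
  classical
  rw [ncmcAccRate_eq_one_sub_tvDist S hP hst]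
  have hF1 := sum_pathLaw_gibbs_eq_one S hP
  have hR1 := sum_revPathLaw S P hst
  have hpin := Literature.Probability.Entropy.two_mul_tvDist_sq_le_kl
    (pathLaw_pos (gibbsLaw_pos (S 0)) hPpos) (revPathLaw_pos S hPpos) hF1 hR1
  have hkl : ∑ ω : Fin (n + 1) → X, pathLaw (gibbsLaw (S 0)) P ω *
      Real.log (pathLaw (gibbsLaw (S 0)) P ω / revPathLaw S P ω) =
      (∑ ω : Fin (n + 1) → X, pathLaw (gibbsLaw (S 0)) P ω * work S ω) -
        (freeEnergy (S (Fin.last n)) - freeEnergy (S 0)) := by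
    have h := kl_path_eq_dissipation S P hP hPpos
    simp only [klFin] at h
    rw [h, partitionFn_div_eq_exp_neg_freeEnergy_sub, Real.log_exp]
    ring
  rw [hkl] at hpin
  have htv : tvDist (pathLaw (gibbsLaw (S 0)) P) (revPathLaw S P) ≤
      Real.sqrt (((∑ ω : Fin (n + 1) → X, pathLaw (gibbsLaw (S 0)) P ω * work S ω) -
        (freeEnergy (S (Fin.last n)) - freeEnergy (S 0))) / 2) :=
    calc tvDist (pathLaw (gibbsLaw (S 0)) P) (revPathLaw S P)
        = Real.sqrt (tvDist (pathLaw (gibbsLaw (S 0)) P) (revPathLaw S P) ^ 2) :=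
          (Real.sqrt_sq (tvDist_nonneg _ _)).symm
      _ ≤ _ := Real.sqrt_le_sqrt (by linarith)
  linarith

/-! ## Frozen exterior: the NCMC acceptance obeys the same exterior-only cap as path-IMH -/

section Frozen

variable {Y : Type*} [Fintype Y] {Ω : Type*} [Fintype Ω]

/-- Under per-exterior Jarzynski the work-tilted law is the forward law tilted by the dissipation
measured from the ANNEALED free-energy difference: `tilted = fwd · e^{-(W − annealedDeltaF)}`. -/
theorem frozenTiltedLaw_eq_fwd_mul_exp {p : Y → ℝ} {q W : Y → Ω → ℝ} {dF : Y → ℝ}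
    (hp : ∀ y, 0 ≤ p y) (hsum : ∑ y, p y = 1)
    (hJ : ∀ y, ∑ ω, q y ω * Real.exp (-W y ω) = Real.exp (-dF y)) (z : Y × Ω) :
    frozenTiltedLaw p q W z =
      frozenFwdLaw p q z * Real.exp (-(W z.1 z.2 - annealedDeltaF p dF)) := by
  have hpos := mixtureSum_pos (dF := dF) hp hsum
  have hZ : ∑ y, p y * ∑ ω, q y ω * Real.exp (-W y ω) = Real.exp (-annealedDeltaF p dF) := by
    rw [tiltedNormaliser_eq hJ]
    unfold annealedDeltaF
    rw [neg_neg, Real.exp_log hpos]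
  unfold frozenTiltedLaw frozenFwdLaw
  rw [hZ, div_eq_mul_inv, ← Real.exp_neg, neg_neg, mul_assoc, ← Real.exp_add]
  congr 2
  ring

/-- Hence the NCMC functional of the frozen-exterior protocol, `Σ fwd · min(1, e^{-(W − annealedΔF)})`,
is `Σ min(fwd, tilted)`. -/
theorem sum_min_frozen_eq {p : Y → ℝ} {q W : Y → Ω → ℝ} {dF : Y → ℝ}
    (hp : ∀ y, 0 ≤ p y) (hsum : ∑ y, p y = 1) (hq : ∀ y ω, 0 ≤ q y ω)
    (hJ : ∀ y, ∑ ω, q y ω * Real.exp (-W y ω) = Real.exp (-dF y)) :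
    ∑ z, frozenFwdLaw p q z * min 1 (Real.exp (-(W z.1 z.2 - annealedDeltaF p dF))) =
      ∑ z, min (frozenFwdLaw p q z) (frozenTiltedLaw p q W z) := by
  refine sum_congr rfl fun z _ => ?_
  have hf : 0 ≤ frozenFwdLaw p q z := mul_nonneg (hp _) (hq _ _)
  rw [mul_min_of_nonneg _ _ hf, mul_one, ← frozenTiltedLaw_eq_fwd_mul_exp hp hsum hJ]

/-- **NCMC acceptance cap of a frozen-exterior protocol:** `Σ min(fwd, tilted) = 1 − TV(fwd, tilted)
≤ 1 − TV(π₁^ext, π₀^ext)` — for every number of steps and every exterior-freezing interior kernel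
(data processing `tvDist_fstMarginal_le` onto the exterior; the marginals are `exteriorTarget p ΔF`
and `p`). -/
theorem sum_min_frozen_le_one_sub_tvDist {p : Y → ℝ} {q W : Y → Ω → ℝ} {dF : Y → ℝ}
    (hp : ∀ y, 0 ≤ p y) (hsum : ∑ y, p y = 1) (hqs : ∀ y, ∑ ω, q y ω = 1)
    (hJ : ∀ y, ∑ ω, q y ω * Real.exp (-W y ω) = Real.exp (-dF y)) :
    ∑ z, min (frozenFwdLaw p q z) (frozenTiltedLaw p q W z) ≤ 1 - tvDist (exteriorTarget p dF) p := by
  rw [sum_min_eq_one_sub_tvDist (sum_frozenFwdLaw hsum hqs) (sum_frozenTiltedLaw hp hsum hJ),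
    tvDist_comm]
  have h2 := tvDist_fstMarginal_le (frozenTiltedLaw p q W) (frozenFwdLaw p q)
  rw [fstMarginal_frozenTiltedLaw hJ, fstMarginal_frozenFwdLaw p hqs] at h2
  linarith

/-- … and it dominates the path-IMH acceptance of the same protocol
(`accRate_frozen_le_one_sub_tvDist` is the composite of the two). -/
theorem accRate_frozen_le_sum_min_frozen {p : Y → ℝ} {q W : Y → Ω → ℝ} {dF : Y → ℝ}
    (hp : ∀ y, 0 ≤ p y) (hsum : ∑ y, p y = 1) (hqs : ∀ y, ∑ ω, q y ω = 1)
    (hJ : ∀ y, ∑ ω, q y ω * Real.exp (-W y ω) = Real.exp (-dF y)) :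
    accRate (frozenTiltedLaw p q W) (frozenFwdLaw p q) ≤
      ∑ z, min (frozenFwdLaw p q z) (frozenTiltedLaw p q W z) := by
  classical
  rw [sum_min_eq_one_sub_tvDist (sum_frozenFwdLaw hsum hqs) (sum_frozenTiltedLaw hp hsum hJ),
    tvDist_comm]
  exact accRate_le (sum_frozenTiltedLaw hp hsum hJ) (sum_frozenFwdLaw hsum hqs)

end Frozen

end Summit.Ventures.LatticeQCDFlow.Exactness
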